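import Summits.AtomisticToContinuum.FouriersLaw.Theorems.EmbeddedDrudeMourreFiniteResponseOfUniqueFundamentalMatrix
import Literature.MathematicalPhysics.KineticTheory.LangevinSemigroupProofs

/-!
# `FiniteResponseOfUnique` (stmt-AtomisticToContinuum-0717): the sensitivity representation for the item's family

`--supports` helper file (route decl
`Summit.AtomisticToContinuum.FouriersLaw.Theses.EmbeddedDrudeMourre.FiniteResponseOfUnique`): joins
the identification of the unique weak steady state with the CEHR invariant measure (Harris
uniqueness, `pinnedChainSemigroup_ergodic`, plus weak-NESS uniqueness) and the fundamental-matrix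
representation (`EmbeddedDrudeMourreFiniteResponseOfUniqueFundamentalMatrix.lean` §4) into the exact
identity
`μ_δ(j_i) = μ_δ((P^{T+δ/2,T-δ/2}_{t₀} - P^{T,T}_{t₀}) G_i)` for the steady-state family of the item
(`|δ| < 2T`), the first line of the Hairer–Majda linear-response argument.
-/

noncomputable section

namespace Summit.AtomisticToContinuum.FouriersLaw.Theorems.FiniteResponse

open MeasureTheory Filter Topology
open Literature.MathematicalPhysics.KineticTheory.HeatConduction

/-! ## §7 The fundamental-matrix representation for the steady-state family of the item -/

section Family

variable {ω₂ lam β γ : ℝ}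

/-- **`μ_δ(j_i) = μ_δ((P^δ_{t₀} - P⁰_{t₀}) G_i)` for the item's family.** Under weak-NESS uniqueness
at length `N ≥ 1`, for a steady-state family `μ`, an equilibrium temperature `T > 0`, a
temperature difference `|δ| < 2T`, a weight `0 < ϑ < 1/(T + |δ|/2)`, a skeleton step `t₀ > 0` and
a bond `i`: with `G_i = Σₙ P⁰_{n t₀} j_i` the Poisson sum of the bond current at temperature `T`
(strongly measurable, `|G_i| ≤ C' e^{ϑH}`, `G_i = j_i + P⁰_{t₀} G_i`), the steady current is the
steady expectation of the finite-time kernel sensitivity: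
`∫ j_i dμ_{T+δ/2,T-δ/2} = ∫ (P^{T+δ/2,T-δ/2}_{t₀} G_i - P^{T,T}_{t₀} G_i) dμ_{T+δ/2,T-δ/2}`.
What remains of item 0717 after this identity: the limit `δ → 0` of
`(P^{T+δ/2,T-δ/2}_{t₀} - P^{T,T}_{t₀}) G_i / δ` (Hairer–Majda Assumption 1-type weighted `C¹`
control of `G_i`) and the weak continuity of `δ ↦ μ_δ` at `0`. [Hairer–Majda 2010, proof of
Thm 2.3] [folklore] -/
theorem integral_bondCurrent_family_eq_sensitivity (hω : 0 < ω₂) (hl : 0 ≤ lam) (hβ : 0 < β)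
    (hγ : 0 < γ) {N : ℕ} (hN : 0 < N) {T : ℝ} (hT : 0 < T)
    (huniq : ∀ (T_L T_R : ℝ), 0 < T_L → 0 < T_R → ∀ μ ν : Measure (PhaseSpace N),
      (pinnedChain ω₂ lam β γ).IsSteadyState N T_L T_R μ →
        (pinnedChain ω₂ lam β γ).IsSteadyState N T_L T_R ν → μ = ν)
    (μ : ℝ → ℝ → Measure (PhaseSpace N))
    (hμ : ∀ T_L T_R : ℝ, 0 < T_L → 0 < T_R →
      (pinnedChain ω₂ lam β γ).IsSteadyState N T_L T_R (μ T_L T_R))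
    {δ : ℝ} (hδ : |δ| < 2 * T) {ϑ : ℝ} (hϑ0 : 0 < ϑ) (hϑ1 : ϑ < 1 / (T + |δ| / 2))
    (t₀ : NNReal) (ht₀ : 0 < t₀) (i : Fin N) :
    ∃ G : PhaseSpace N → ℝ, StronglyMeasurable G ∧
      (∃ C' : ℝ, 0 < C' ∧
        ∀ x, |G x| ≤ C' * Real.exp (ϑ * (pinnedChain ω₂ lam β γ).hamiltonian N x)) ∧
      (∀ x, G x = (pinnedChain ω₂ lam β γ).bondCurrent N i x +
        ∫ y, G y ∂((pinnedChain ω₂ lam β γ).transitionKernel N T T t₀ x)) ∧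
      ∫ x, (pinnedChain ω₂ lam β γ).bondCurrent N i x ∂(μ (T + δ / 2) (T - δ / 2)) =
        ∫ x, ((∫ y, G y ∂((pinnedChain ω₂ lam β γ).transitionKernel N (T + δ / 2) (T - δ / 2) t₀ x)) -
          ∫ y, G y ∂((pinnedChain ω₂ lam β γ).transitionKernel N T T t₀ x))
          ∂(μ (T + δ / 2) (T - δ / 2)) := by
  have hδ' := abs_lt.1 hδ
  have hL : 0 < T + δ / 2 := by linarith
  have hR : 0 < T - δ / 2 := by linarith
  have hmax : max (T + δ / 2) (T - δ / 2) ≤ T + |δ| / 2 := by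
    rcases le_or_gt 0 δ with h | h
    · rw [abs_of_nonneg h]; exact max_le le_rfl (by linarith)
    · rw [abs_of_neg h]; exact max_le (by linarith) (by linarith)
  have hmaxpos : 0 < max (T + δ / 2) (T - δ / 2) := lt_max_of_lt_left hL
  have hϑ2 : ϑ < 1 / max (T + δ / 2) (T - δ / 2) :=
    hϑ1.trans_le (one_div_le_one_div_of_le hmaxpos hmax)
  have hϑT : ϑ < 1 / T :=
    hϑ1.trans_le (one_div_le_one_div_of_le hT (by linarith [abs_nonneg δ]))
  have hss := hμ (T + δ / 2) (T - δ / 2) hL hR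
  haveI := hss.1
  -- identification with the CEHR invariant measure (Harris uniqueness + weak-NESS uniqueness)
  obtain ⟨-, μs, hμs, hinv, hrest⟩ := pinnedChainSemigroup_ergodic hω hl hβ hγ hN hL hR
  have hmax1 : 0 < 1 / max (T + δ / 2) (T - δ / 2) := by positivity
  have hss' : (pinnedChain ω₂ lam β γ).IsSteadyState N (T + δ / 2) (T - δ / 2) μs :=
    pinnedChain_isSteadyState_of_isInvariant hω.le hl hβ.le γ N _ hinv (half_pos hmax1)
      (hrest _ (half_pos hmax1) (half_lt_self hmax1)).1
  have heq : μ (T + δ / 2) (T - δ / 2) = μs := huniq _ _ hL hR _ _ hss hss'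
  have hinv' : (pinnedChainSemigroup hω hl hβ.le hγ.le hN hL.le hR.le).IsInvariant
      (μ (T + δ / 2) (T - δ / 2)) := heq ▸ hinv
  have hint : Integrable (fun z => Real.exp (ϑ * (pinnedChain ω₂ lam β γ).hamiltonian N z))
      (μ (T + δ / 2) (T - δ / 2)) := heq ▸ (hrest ϑ hϑ0 hϑ2).1
  obtain ⟨G, hGm, hGb, -, hGeq, hrep⟩ := integral_bondCurrent_eq_integral_sensitivity hω hl hβ hγ hN
    hT hL hR hinv' hϑ0 hϑT hϑ2 hint t₀ ht₀ i
  exact ⟨G, hGm, hGb, hGeq, hrep⟩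

end Family

end Summit.AtomisticToContinuum.FouriersLaw.Theorems.FiniteResponse

end
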